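import Summits.QuantumFields.BalabanUV.T4Continuum.Support.GradientRowSumTransport
import Summits.QuantumFields.BalabanUV.T4Continuum.Support.SmallCouplingEntryDecayRel

/-!
# T⁴ programme, NE2 (U1a) sub-row Δ3 (`T4-U1a.S-NE2-D3-WALK°`) — `hdec` AT SMALL COUPLING FOR FIRST-ORDER MODEL PERTURBATIONS:
# `P_k = Σ_ν C_ν(k)·(∇_ν ⊗ 1) + C₀(k)` on King's tower over a CUBIC unit torus, via the transported (1.110) second entry

NE2 formalisation swarm `b2b-balaban-t4-ne2-formalise-*`, leaf prover 05 (gen 6); file 2 of the supplier item «NE2-Δ3-GRAD-TRANSPORT»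
(INTENT CLAIMS.log 2026-08-20T14:56Z).  Gen 5's `Support/SmallCouplingEntryDecayRel.hdec_pertCovC_small_rel` (p220908) turns the WEIGHTED
(H-bd)-ANALOGUE `hPG : Σ_j e^{δ′ρ}‖(P_k·(𝒢^{(k)}⊗1))(i,j)‖ ≤ κ_w` into `hdec` (entry decay of the King-averaged colour tower
`pertCovC P t k`) at small coupling, and displayed `hPG` «dischargeable today only for perturbations bounded in the weighted norm».  File 1
(`Support/GradientRowSumTransport`) transported the NE3 lineage's (1.110) second entry — `n`-uniform weighted row sums of `∇_ν·Δ_1⁻¹` on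
cubic unit tori.  THIS FILE discharges `hPG` for the FIRST-ORDER MODEL CLASS and reads off `hdec`:
 * §1 `wrow_add_le`, `wrow_sum_le` (weighted rows are subadditive), `wrow_kron_one_eq` (the colour lift `X ⊗ 1` has the weighted rows of `X`);
 * §2 **`wrow_fdiff_calGlev_kron_le`**: on King's tower `n_k = L^k` over the cubic unit torus `M ≡ N₀`, for `δ′ < δ_∇`:
   `Σ_j e^{δ′|blk i − blk j|_∞}‖((∇_ν·𝒢^{(k)}) ⊗ 1)(i,j)‖ ≤ B_∇·K_{d+1}(δ_∇ − δ′)` at EVERY level (file 1 at `n = n_k`, pv15's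
   `calG_eq_DeltaA_inv`), for any constants `(B_∇, δ_∇)` satisfying file 1's packaged statement;
 * §3 **`wrow_firstOrder_mul_calGlev_le`** = `hPG` DISCHARGED for `P_k = Σ_ν C_ν k·(∇_ν ⊗ 1) + C₀ k` with LEFT coefficient kernels of
   level-uniform weighted rows `≤ κ₁` (each `ν`) and `≤ κ₀`: `κ_w = (d+1)·κ₁·B_∇K_{d+1}(δ_∇ − δ′) + κ₀·W_G(δ′)` (mixed-product rule
   `(C·(∇⊗1))·(𝒢⊗1) = C·((∇𝒢)⊗1)`, submultiplicativity `WeightedRowSumResolvent.wrow_mul_le`, gen 5's `wrow_calGlev_kron_le`);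
 * §4 **`hdec_pertCovC_firstOrder`**: `‖t‖·κ_w < 1 ⟹ ∀ k, EntryDecay dist₀ (pertCovC L M 1 _ P t k) (W_G(δ′)/(1 − ‖t‖κ_w)) δ′` — gen 5's
   `hdec_pertCovC_small_rel` BY NAME; **`hdec_pertCovC_firstOrder_cubic`**: the packaged `∃ B_∇ δ_∇ > 0` form (file 1's
   `weighted_row_sum_fdiff_inv_le_cubic`, i.e. NE3's constants); kernel `example`: the class is inhabited by bounded DRIFTS
   `Σ_ν diag(a_ν)·(∇_ν ⊗ 1)`, `‖a_ν‖_∞ ≤ α` (gen 5's `wrow_diagonal_le`) — an `hdec` for an UNBOUNDED (first-order) perturbation family.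

HONEST FRAMING (T4-DAG p. 1).  MODEL level: first-order perturbations with LEFT coefficient kernels bounded in the weighted `ℓ^∞ → ℓ^∞`
norm — NOT tier B's `balabanPert` (its coefficients are Bałaban's transporters/averagings and its divergence-form pieces `(∇_ν*⊗1)·C` need
COLUMN sums of `∇𝒢`, not supplied); `U = 1` propagators, `a = 1`, CUBIC unit tori `M ≡ N₀` only (the NE3 carrier); constants crude
(NE3's existential `B_∇, δ_∇`, pv15's `W_G`); nothing printed asserted — [B5] p.35 (1.110) is a TEXT LOCATION; sub-row Δ3 NOT closed for
Bałaban's carrier; nothing of NE3's node; **NE2 (U1a) NOT PROVED**; spine PROVED 0/9; NOT infinite volume, NOT a mass gap, NOT Clay.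
HONEST DEPENDENCY: continuum YM on T⁴ ⇐ BetaPertH ∧ nine spine estimates (0/9 proved); BetaPertH ⇐ (D1) ∧ (D4) ∧ CAP+tail; G-an2-4
gates asym, D1 and NE2/3/4.  ABSOLUTE RULE kept; no `def`; no `sorry`.
-/

noncomputable section

open scoped BigOperators ComplexConjugate Matrix Kronecker
open Finset

namespace Summit.QuantumFields.BalabanUV.T4Continuum.SmallCouplingEntryDecayGrad

open Literature.MathematicalPhysics.QuantumFieldTheory.Balaban1983to89.B5Prop11Plancherel (Tor fine fdiff)
open Literature.MathematicalPhysics.QuantumFieldTheory.Balaban1983to89.B5G183RateUnitTower (lev)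
open Literature.MathematicalPhysics.QuantumFieldTheory.Balaban1983to89.B4TorusKernel (periodConst)
open Literature.MathematicalPhysics.QuantumFieldTheory.Balaban1983to89.B4TorusKernel.MultiPeriod (torusSupNorm)
open Literature.MathematicalPhysics.QuantumFieldTheory.Balaban1983to89.B4Sect5Proof (latticeConst)
open Literature.MathematicalPhysics.QuantumFieldTheory.Balaban1983to89.B5Blocks16 (blockOf)
open Literature.MathematicalPhysics.QuantumFieldTheory.Balaban1983to89.B5DeltaA169 (DeltaA calG_eq_DeltaA_inv)
open Literature.MathematicalPhysics.QuantumFieldTheory.Balaban1983to89.B5G183Strip (kappa183)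
open Literature.MathematicalPhysics.QuantumFieldTheory.Balaban1983to89.B5G183CovDecay (MD183)
open Literature.MathematicalPhysics.QuantumFieldTheory.Balaban1983to89.B6LowerBound2153Torus (rep)
open Summit.QuantumFields.BalabanUV.T4Continuum
open Summit.QuantumFields.BalabanUV.T4Continuum.BalabanAveragedTowerUnit (idx calGlev one_le_lev')
open Summit.QuantumFields.BalabanUV.T4Continuum.NE2ColourPerturbedLayer (pertCovC)
open Summit.QuantumFields.BalabanUV.T4Continuum.DecayRateInterpolation (EntryDecay)
open Summit.QuantumFields.BalabanUV.T4Continuum.WeightedRowSumResolvent (wrow_mul_le wrow_nonneg)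
open Summit.QuantumFields.BalabanUV.T4Continuum.SmallCouplingEntryDecay (torusSupNorm_rep_triangle torusSupNorm_rep_nonneg
  wrow_calGlev_kron_le wrow_diagonal_le)
open Summit.QuantumFields.BalabanUV.T4Continuum.SmallCouplingEntryDecayRel (hdec_pertCovC_small_rel)
open Summit.QuantumFields.BalabanUV.T4Continuum.GradientRowSumTransport (weighted_row_sum_fdiff_inv_le_cubic)

/-! ## §1 Weighted rows: subadditivity and the colour lift -/

section Rows

variable {ι : Type*} [Fintype ι]

/-- weighted row sums are subadditive. [folklore] -/
theorem wrow_add_le (w : ι → ι → ℝ) (hw : ∀ i j, 0 ≤ w i j) (A B : Matrix ι ι ℂ) (i : ι) :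
    ∑ j, w i j * ‖(A + B) i j‖ ≤ ∑ j, w i j * ‖A i j‖ + ∑ j, w i j * ‖B i j‖ := by
  rw [← Finset.sum_add_distrib]
  refine Finset.sum_le_sum fun j _ => ?_
  rw [Matrix.add_apply, ← mul_add]
  exact mul_le_mul_of_nonneg_left (norm_add_le _ _) (hw i j)

/-- weighted row sums of a finite sum of matrices. [folklore] -/
theorem wrow_sum_le {α : Type*} (s : Finset α) (w : ι → ι → ℝ) (hw : ∀ i j, 0 ≤ w i j) (A : α → Matrix ι ι ℂ) (i : ι) :
    ∑ j, w i j * ‖(∑ a ∈ s, A a) i j‖ ≤ ∑ a ∈ s, ∑ j, w i j * ‖A a i j‖ := by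
  classical
  induction s using Finset.induction_on with
  | empty => simp
  | insert a s ha ih =>
      rw [Finset.sum_insert ha, Finset.sum_insert ha]
      exact (wrow_add_le w hw _ _ i).trans (add_le_add le_rfl ih)

end Rows

section Tower

variable {d : ℕ} (L : ℕ) [NeZero L] (M : Fin (d + 1) → ℕ) [hM : ∀ μ, NeZero (M μ)]
variable {o : Type*} [Fintype o] [DecidableEq o]

/-- **the colour lift `X ⊗ 1` has the weighted rows of `X`** (the weight depends on the fine indices only). [folklore] -/
theorem wrow_kron_one_eq (k : ℕ) (X : Matrix (idx L M k) (idx L M k) ℂ) (ρ : idx L M k → idx L M k → ℝ) (δ' : ℝ)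
    (i : idx L M k × o) :
    ∑ j : idx L M k × o, Real.exp (δ' * ρ i.1 j.1) * ‖(X ⊗ₖ (1 : Matrix o o ℂ)) i j‖
      = ∑ v : idx L M k, Real.exp (δ' * ρ i.1 v) * ‖X i.1 v‖ := by
  obtain ⟨u, c⟩ := i
  rw [Fintype.sum_prod_type]
  refine Finset.sum_congr rfl fun v _ => ?_
  rw [Finset.sum_eq_single c]
  · simp [Matrix.kroneckerMap_apply]
  · intro c' _ hc'
    simp [Matrix.kroneckerMap_apply, Ne.symm hc']
  · simp

/-! ## §2 The gradient rows on King's tower over a cubic unit torus -/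

/-- **WEIGHTED ROWS OF `(∇_ν·𝒢^{(k)}) ⊗ 1` ON KING's TOWER OVER A CUBIC UNIT TORUS**: for constants `(B, δ_∇)` satisfying file 1's
packaged statement (`GradientRowSumTransport.weighted_row_sum_fdiff_inv_le_cubic`), `M ≡ N₀`, `δ′ < δ_∇`, every level `k`, direction `ν`,
row `i`: `Σ_j e^{δ′|blk i − blk j|_∞}‖((∇_ν·𝒢^{(k)}) ⊗ 1)(i,j)‖ ≤ B·K_{d+1}(δ_∇ − δ′)` (`𝒢^{(k)} = calGlev L M 1 _ k = (DeltaA n_k M 1)⁻¹`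
by pv15's `calG_eq_DeltaA_inv`). [folklore] -/
theorem wrow_fdiff_calGlev_kron_le {B δg : ℝ}
    (hgrad : ∀ (n N₀ : ℕ) [NeZero n] [NeZero N₀] (δ' : ℝ), δ' < δg →
      ∀ (ν : Fin (d + 1)) (i : Tor (fine n (fun _ : Fin (d + 1) => N₀)) × Fin (d + 1)),
        ∑ x' : Tor (fine n (fun _ : Fin (d + 1) => N₀)) × Fin (d + 1),
            Real.exp (δ' * torusSupNorm (fun _ : Fin (d + 1) => N₀)
                (rep (fun _ : Fin (d + 1) => N₀) (blockOf n (fun _ : Fin (d + 1) => N₀) i.1)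
                  - rep (fun _ : Fin (d + 1) => N₀) (blockOf n (fun _ : Fin (d + 1) => N₀) x'.1)))
              * ‖(fdiff (fine n (fun _ : Fin (d + 1) => N₀)) (n : ℂ) ν * (DeltaA n (fun _ : Fin (d + 1) => N₀) 1)⁻¹) i x'‖
          ≤ B * latticeConst (d + 1) (δg - δ'))
    (N₀ : ℕ) [NeZero N₀] (hMc : M = fun _ => N₀) {δ' : ℝ} (hδ' : δ' < δg) (k : ℕ) (ν : Fin (d + 1)) (i : idx L M k × o) :
    ∑ j : idx L M k × o, Real.exp (δ' * torusSupNorm M (rep M (blockOf (lev L k) M i.1.1) - rep M (blockOf (lev L k) M j.1.1)))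
        * ‖((fdiff (fine (lev L k) M) ((lev L k : ℕ) : ℂ) ν * calGlev L M 1 one_pos k) ⊗ₖ (1 : Matrix o o ℂ)) i j‖
      ≤ B * latticeConst (d + 1) (δg - δ') := by
  subst hMc
  rw [wrow_kron_one_eq L _ k _ (fun u v => torusSupNorm (fun _ : Fin (d + 1) => N₀)
    (rep (fun _ : Fin (d + 1) => N₀) (blockOf (lev L k) (fun _ : Fin (d + 1) => N₀) u.1)
      - rep (fun _ : Fin (d + 1) => N₀) (blockOf (lev L k) (fun _ : Fin (d + 1) => N₀) v.1))) δ' i]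
  have hG : calGlev L (fun _ : Fin (d + 1) => N₀) 1 one_pos k = (DeltaA (lev L k) (fun _ : Fin (d + 1) => N₀) 1)⁻¹ :=
    calG_eq_DeltaA_inv (lev L k) (one_le_lev' L k) _ 1 one_pos
  rw [hG]
  exact hgrad (lev L k) N₀ δ' hδ' ν i.1

/-! ## §3 `hPG` discharged for the first-order model class `P_k = Σ_ν C_ν k·(∇_ν ⊗ 1) + C₀ k` -/

/-- **`hPG` FOR THE FIRST-ORDER MODEL CLASS**: on King's tower over the cubic unit torus `M ≡ N₀`, for LEFT coefficient kernels
`C_ν k`, `C₀ k` with level-uniform weighted rows `≤ κ₁` (every `ν`) and `≤ κ₀` at a rate `δ′ < min(δ_∇, δ₁, δ₂)`, `0 ≤ δ′`, and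
`P_k := Σ_ν C_ν k·(∇_ν ⊗ 1) + C₀ k`:
`Σ_j e^{δ′|blk i − blk j|_∞}‖(P_k·(𝒢^{(k)} ⊗ 1))(i,j)‖ ≤ (d+1)·κ₁·B·K_{d+1}(δ_∇ − δ′) + κ₀·W_G(δ′)` at EVERY level — the mixed-product rule
`(C·(∇_ν⊗1))·(𝒢⊗1) = C·((∇_ν𝒢)⊗1)`, submultiplicativity of weighted rows, §2 and gen 5's `wrow_calGlev_kron_le`. [folklore] -/
theorem wrow_firstOrder_mul_calGlev_le {B δg : ℝ}
    (hgrad : ∀ (n N₀ : ℕ) [NeZero n] [NeZero N₀] (δ' : ℝ), δ' < δg →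
      ∀ (ν : Fin (d + 1)) (i : Tor (fine n (fun _ : Fin (d + 1) => N₀)) × Fin (d + 1)),
        ∑ x' : Tor (fine n (fun _ : Fin (d + 1) => N₀)) × Fin (d + 1),
            Real.exp (δ' * torusSupNorm (fun _ : Fin (d + 1) => N₀)
                (rep (fun _ : Fin (d + 1) => N₀) (blockOf n (fun _ : Fin (d + 1) => N₀) i.1)
                  - rep (fun _ : Fin (d + 1) => N₀) (blockOf n (fun _ : Fin (d + 1) => N₀) x'.1)))
              * ‖(fdiff (fine n (fun _ : Fin (d + 1) => N₀)) (n : ℂ) ν * (DeltaA n (fun _ : Fin (d + 1) => N₀) 1)⁻¹) i x'‖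
          ≤ B * latticeConst (d + 1) (δg - δ'))
    (N₀ : ℕ) [NeZero N₀] (hMc : M = fun _ => N₀) {δ' : ℝ} (hδ0 : 0 ≤ δ') (hδg : δ' < δg)
    (h₁ : δ' < 1 / (2 * ((d : ℝ) + 1))) (h₂ : δ' < kappa183 (d + 1) / (d + 1))
    {C : Fin (d + 1) → (k : ℕ) → Matrix (idx L M k × o) (idx L M k × o) ℂ}
    {C₀ : (k : ℕ) → Matrix (idx L M k × o) (idx L M k × o) ℂ} {κ₁ κ₀ : ℝ}
    (hC : ∀ ν k (i : idx L M k × o), ∑ j, Real.exp (δ' * torusSupNorm M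
        (rep M (blockOf (lev L k) M i.1.1) - rep M (blockOf (lev L k) M j.1.1))) * ‖C ν k i j‖ ≤ κ₁)
    (hC₀ : ∀ k (i : idx L M k × o), ∑ j, Real.exp (δ' * torusSupNorm M
        (rep M (blockOf (lev L k) M i.1.1) - rep M (blockOf (lev L k) M j.1.1))) * ‖C₀ k i j‖ ≤ κ₀)
    (k : ℕ) (i : idx L M k × o) :
    ∑ j, Real.exp (δ' * torusSupNorm M (rep M (blockOf (lev L k) M i.1.1) - rep M (blockOf (lev L k) M j.1.1)))
        * ‖(((∑ ν, C ν k * (fdiff (fine (lev L k) M) ((lev L k : ℕ) : ℂ) ν ⊗ₖ (1 : Matrix o o ℂ))) + C₀ k)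
            * (calGlev L M 1 one_pos k ⊗ₖ (1 : Matrix o o ℂ))) i j‖
      ≤ (d + 1) * (κ₁ * (B * latticeConst (d + 1) (δg - δ')))
        + κ₀ * (2 * d * 2 ^ d * Real.exp (1 / (2 * (d + 1))) * latticeConst (d + 1) (1 / (2 * (d + 1)) - δ')
            + (d + 1) * (MD183 (d + 1) d * periodConst (kappa183 (d + 1)) d * latticeConst (d + 1) (kappa183 (d + 1) / (d + 1) - δ'))) := by
  set ρ : idx L M k × o → idx L M k × o → ℝ := fun i j =>
    torusSupNorm M (rep M (blockOf (lev L k) M i.1.1) - rep M (blockOf (lev L k) M j.1.1)) with hρ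
  have htri : ∀ i j m, ρ i m ≤ ρ i j + ρ j m := fun i j m => torusSupNorm_rep_triangle M _ _ _
  have hw : ∀ i j : idx L M k × o, 0 ≤ Real.exp (δ' * ρ i j) := fun i j => (Real.exp_pos _).le
  -- the mixed-product rule
  have hmix : ((∑ ν, C ν k * (fdiff (fine (lev L k) M) ((lev L k : ℕ) : ℂ) ν ⊗ₖ (1 : Matrix o o ℂ))) + C₀ k)
        * (calGlev L M 1 one_pos k ⊗ₖ (1 : Matrix o o ℂ))
      = (∑ ν, C ν k * ((fdiff (fine (lev L k) M) ((lev L k : ℕ) : ℂ) ν * calGlev L M 1 one_pos k) ⊗ₖ (1 : Matrix o o ℂ)))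
        + C₀ k * (calGlev L M 1 one_pos k ⊗ₖ (1 : Matrix o o ℂ)) := by
    rw [Matrix.add_mul, Finset.sum_mul]
    congr 1
    refine Finset.sum_congr rfl fun ν _ => ?_
    rw [Matrix.mul_assoc, ← Matrix.mul_kronecker_mul, Matrix.one_mul]
  rw [hmix]
  -- the two row bounds of the right factors
  have hgradk : ∀ ν (j : idx L M k × o), ∑ m, Real.exp (δ' * ρ j m)
      * ‖((fdiff (fine (lev L k) M) ((lev L k : ℕ) : ℂ) ν * calGlev L M 1 one_pos k) ⊗ₖ (1 : Matrix o o ℂ)) j m‖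
        ≤ B * latticeConst (d + 1) (δg - δ') := fun ν j =>
    wrow_fdiff_calGlev_kron_le L M hgrad N₀ hMc hδg k ν j
  have hGk : ∀ j : idx L M k × o, ∑ m, Real.exp (δ' * ρ j m) * ‖(calGlev L M 1 one_pos k ⊗ₖ (1 : Matrix o o ℂ)) j m‖
      ≤ 2 * d * 2 ^ d * Real.exp (1 / (2 * (d + 1))) * latticeConst (d + 1) (1 / (2 * (d + 1)) - δ')
          + (d + 1) * (MD183 (d + 1) d * periodConst (kappa183 (d + 1)) d
            * latticeConst (d + 1) (kappa183 (d + 1) / (d + 1) - δ')) := fun j =>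
    wrow_calGlev_kron_le L M h₁ h₂ k j
  -- nonnegativity of the two right bounds (each dominates a nonnegative row sum)
  have hWgrad : 0 ≤ B * latticeConst (d + 1) (δg - δ') := (wrow_nonneg ρ δ' _ i).trans (hgradk 0 i)
  have hWG : 0 ≤ 2 * d * 2 ^ d * Real.exp (1 / (2 * (d + 1))) * latticeConst (d + 1) (1 / (2 * (d + 1)) - δ')
      + (d + 1) * (MD183 (d + 1) d * periodConst (kappa183 (d + 1)) d
        * latticeConst (d + 1) (kappa183 (d + 1) / (d + 1) - δ')) := (wrow_nonneg ρ δ' _ i).trans (hGk i)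
  -- each first-order summand
  have hterm : ∀ ν, ∑ m, Real.exp (δ' * ρ i m)
      * ‖(C ν k * ((fdiff (fine (lev L k) M) ((lev L k : ℕ) : ℂ) ν * calGlev L M 1 one_pos k) ⊗ₖ (1 : Matrix o o ℂ))) i m‖
        ≤ κ₁ * (B * latticeConst (d + 1) (δg - δ')) := fun ν =>
    (wrow_mul_le htri hδ0 _ _ (hgradk ν) i).trans (mul_le_mul_of_nonneg_right (hC ν k i) hWgrad)
  -- the zeroth-order summand
  have hzero : ∑ m, Real.exp (δ' * ρ i m) * ‖(C₀ k * (calGlev L M 1 one_pos k ⊗ₖ (1 : Matrix o o ℂ))) i m‖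
      ≤ κ₀ * (2 * d * 2 ^ d * Real.exp (1 / (2 * (d + 1))) * latticeConst (d + 1) (1 / (2 * (d + 1)) - δ')
          + (d + 1) * (MD183 (d + 1) d * periodConst (kappa183 (d + 1)) d
            * latticeConst (d + 1) (kappa183 (d + 1) / (d + 1) - δ'))) :=
    (wrow_mul_le htri hδ0 _ _ hGk i).trans (mul_le_mul_of_nonneg_right (hC₀ k i) hWG)
  -- assemble
  refine (wrow_add_le (fun i j => Real.exp (δ' * ρ i j)) hw _ _ i).trans (add_le_add ?_ hzero)
  refine (wrow_sum_le Finset.univ (fun i j => Real.exp (δ' * ρ i j)) hw _ i).trans ?_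
  calc ∑ ν : Fin (d + 1), ∑ m, Real.exp (δ' * ρ i m)
          * ‖(C ν k * ((fdiff (fine (lev L k) M) ((lev L k : ℕ) : ℂ) ν * calGlev L M 1 one_pos k) ⊗ₖ (1 : Matrix o o ℂ))) i m‖
      ≤ ∑ _ν : Fin (d + 1), κ₁ * (B * latticeConst (d + 1) (δg - δ')) := Finset.sum_le_sum fun ν _ => hterm ν
    _ = (d + 1) * (κ₁ * (B * latticeConst (d + 1) (δg - δ'))) := by
        rw [Finset.sum_const, Finset.card_univ, Fintype.card_fin, nsmul_eq_mul]; push_cast; ring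

/-! ## §4 `hdec` at small coupling for the first-order model class -/

/-- **`hdec` AT SMALL COUPLING FOR FIRST-ORDER MODEL PERTURBATIONS** (`a = 1`, dimension `d + 1`, cubic unit torus `M ≡ N₀`): with
`P_k := Σ_ν C_ν k·(∇_ν ⊗ 1) + C₀ k` as in §3, `κ_w := (d+1)·κ₁·B·K_{d+1}(δ_∇ − δ′) + κ₀·W_G(δ′)` and `‖t‖·κ_w < 1`:
`∀ k, EntryDecay dist₀ (pertCovC L M 1 _ P t k) (W_G(δ′)/(1 − ‖t‖κ_w)) δ′` — gen 5's `hdec_pertCovC_small_rel` BY NAME with its displayed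
binder `hPG` DISCHARGED by §3.  MODEL level (LEFT coefficient kernels; not tier B's `balabanPert`); Δ3 NOT closed; NE2 NOT proved.
[folklore] -/
theorem hdec_pertCovC_firstOrder {B δg : ℝ}
    (hgrad : ∀ (n N₀ : ℕ) [NeZero n] [NeZero N₀] (δ' : ℝ), δ' < δg →
      ∀ (ν : Fin (d + 1)) (i : Tor (fine n (fun _ : Fin (d + 1) => N₀)) × Fin (d + 1)),
        ∑ x' : Tor (fine n (fun _ : Fin (d + 1) => N₀)) × Fin (d + 1),
            Real.exp (δ' * torusSupNorm (fun _ : Fin (d + 1) => N₀)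
                (rep (fun _ : Fin (d + 1) => N₀) (blockOf n (fun _ : Fin (d + 1) => N₀) i.1)
                  - rep (fun _ : Fin (d + 1) => N₀) (blockOf n (fun _ : Fin (d + 1) => N₀) x'.1)))
              * ‖(fdiff (fine n (fun _ : Fin (d + 1) => N₀)) (n : ℂ) ν * (DeltaA n (fun _ : Fin (d + 1) => N₀) 1)⁻¹) i x'‖
          ≤ B * latticeConst (d + 1) (δg - δ'))
    (N₀ : ℕ) [NeZero N₀] (hMc : M = fun _ => N₀) {δ' : ℝ} (hδ0 : 0 ≤ δ') (hδg : δ' < δg)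
    (h₁ : δ' < 1 / (2 * ((d : ℝ) + 1))) (h₂ : δ' < kappa183 (d + 1) / (d + 1))
    {C : Fin (d + 1) → (k : ℕ) → Matrix (idx L M k × o) (idx L M k × o) ℂ}
    {C₀ : (k : ℕ) → Matrix (idx L M k × o) (idx L M k × o) ℂ} {κ₁ κ₀ : ℝ}
    (hC : ∀ ν k (i : idx L M k × o), ∑ j, Real.exp (δ' * torusSupNorm M
        (rep M (blockOf (lev L k) M i.1.1) - rep M (blockOf (lev L k) M j.1.1))) * ‖C ν k i j‖ ≤ κ₁)
    (hC₀ : ∀ k (i : idx L M k × o), ∑ j, Real.exp (δ' * torusSupNorm M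
        (rep M (blockOf (lev L k) M i.1.1) - rep M (blockOf (lev L k) M j.1.1))) * ‖C₀ k i j‖ ≤ κ₀)
    {t : ℂ} (ht : ‖t‖ * ((d + 1) * (κ₁ * (B * latticeConst (d + 1) (δg - δ')))
        + κ₀ * (2 * d * 2 ^ d * Real.exp (1 / (2 * (d + 1))) * latticeConst (d + 1) (1 / (2 * (d + 1)) - δ')
            + (d + 1) * (MD183 (d + 1) d * periodConst (kappa183 (d + 1)) d * latticeConst (d + 1) (kappa183 (d + 1) / (d + 1) - δ'))))
        < 1) (k : ℕ) :
    EntryDecay (fun x y : idx L M 0 × o => torusSupNorm M (fun ν => (((x.1.1 ν).val : ℕ) : ℤ) - (((y.1.1 ν).val : ℕ) : ℤ)))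
      (pertCovC L M 1 one_pos
        (fun k => (∑ ν, C ν k * (fdiff (fine (lev L k) M) ((lev L k : ℕ) : ℂ) ν ⊗ₖ (1 : Matrix o o ℂ))) + C₀ k) t k)
      ((2 * d * 2 ^ d * Real.exp (1 / (2 * (d + 1))) * latticeConst (d + 1) (1 / (2 * (d + 1)) - δ')
            + (d + 1) * (MD183 (d + 1) d * periodConst (kappa183 (d + 1)) d * latticeConst (d + 1) (kappa183 (d + 1) / (d + 1) - δ')))
          / (1 - ‖t‖ * ((d + 1) * (κ₁ * (B * latticeConst (d + 1) (δg - δ')))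
              + κ₀ * (2 * d * 2 ^ d * Real.exp (1 / (2 * (d + 1))) * latticeConst (d + 1) (1 / (2 * (d + 1)) - δ')
                + (d + 1) * (MD183 (d + 1) d * periodConst (kappa183 (d + 1)) d
                  * latticeConst (d + 1) (kappa183 (d + 1) / (d + 1) - δ')))))) δ' :=
  hdec_pertCovC_small_rel L M hδ0 h₁ h₂
    (P := fun k => (∑ ν, C ν k * (fdiff (fine (lev L k) M) ((lev L k : ℕ) : ℂ) ν ⊗ₖ (1 : Matrix o o ℂ))) + C₀ k)
    (fun k i => wrow_firstOrder_mul_calGlev_le L M hgrad N₀ hMc hδ0 hδg h₁ h₂ hC hC₀ k i) ht k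

/-- **`hdec` AT SMALL COUPLING FOR FIRST-ORDER MODEL PERTURBATIONS, PACKAGED**: there are `B_∇, δ_∇ > 0` depending on the dimension only
(NE3's constants through file 1) such that §4 holds with them on every King tower over every cubic unit torus. [folklore] -/
theorem hdec_pertCovC_firstOrder_cubic :
    ∃ B δg : ℝ, 0 < B ∧ 0 < δg ∧ ∀ (N₀ : ℕ) [NeZero N₀], M = (fun _ => N₀) →
      ∀ (δ' : ℝ), 0 ≤ δ' → δ' < δg → δ' < 1 / (2 * ((d : ℝ) + 1)) → δ' < kappa183 (d + 1) / (d + 1) →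
      ∀ (C : Fin (d + 1) → (k : ℕ) → Matrix (idx L M k × o) (idx L M k × o) ℂ)
        (C₀ : (k : ℕ) → Matrix (idx L M k × o) (idx L M k × o) ℂ) (κ₁ κ₀ : ℝ),
        (∀ ν k (i : idx L M k × o), ∑ j, Real.exp (δ' * torusSupNorm M
            (rep M (blockOf (lev L k) M i.1.1) - rep M (blockOf (lev L k) M j.1.1))) * ‖C ν k i j‖ ≤ κ₁) →
        (∀ k (i : idx L M k × o), ∑ j, Real.exp (δ' * torusSupNorm M
            (rep M (blockOf (lev L k) M i.1.1) - rep M (blockOf (lev L k) M j.1.1))) * ‖C₀ k i j‖ ≤ κ₀) →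
        ∀ (t : ℂ), ‖t‖ * ((d + 1) * (κ₁ * (B * latticeConst (d + 1) (δg - δ')))
            + κ₀ * (2 * d * 2 ^ d * Real.exp (1 / (2 * (d + 1))) * latticeConst (d + 1) (1 / (2 * (d + 1)) - δ')
              + (d + 1) * (MD183 (d + 1) d * periodConst (kappa183 (d + 1)) d
                * latticeConst (d + 1) (kappa183 (d + 1) / (d + 1) - δ')))) < 1 →
        ∀ (k : ℕ),
          EntryDecay (fun x y : idx L M 0 × o => torusSupNorm M (fun ν => (((x.1.1 ν).val : ℕ) : ℤ) - (((y.1.1 ν).val : ℕ) : ℤ)))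
            (pertCovC L M 1 one_pos
              (fun k => (∑ ν, C ν k * (fdiff (fine (lev L k) M) ((lev L k : ℕ) : ℂ) ν ⊗ₖ (1 : Matrix o o ℂ))) + C₀ k) t k)
            ((2 * d * 2 ^ d * Real.exp (1 / (2 * (d + 1))) * latticeConst (d + 1) (1 / (2 * (d + 1)) - δ')
                  + (d + 1) * (MD183 (d + 1) d * periodConst (kappa183 (d + 1)) d
                    * latticeConst (d + 1) (kappa183 (d + 1) / (d + 1) - δ')))
                / (1 - ‖t‖ * ((d + 1) * (κ₁ * (B * latticeConst (d + 1) (δg - δ')))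
                    + κ₀ * (2 * d * 2 ^ d * Real.exp (1 / (2 * (d + 1))) * latticeConst (d + 1) (1 / (2 * (d + 1)) - δ')
                      + (d + 1) * (MD183 (d + 1) d * periodConst (kappa183 (d + 1)) d
                        * latticeConst (d + 1) (kappa183 (d + 1) / (d + 1) - δ')))))) δ' := by
  obtain ⟨B, δg, hB, hδg, hgrad⟩ := weighted_row_sum_fdiff_inv_le_cubic (d := d)
  exact ⟨B, δg, hB, hδg, fun N₀ _ hMc δ' hδ0 hδ' h₁ h₂ C C₀ κ₁ κ₀ hC hC₀ t ht k =>
    hdec_pertCovC_firstOrder L M hgrad N₀ hMc hδ0 hδ' h₁ h₂ hC hC₀ ht k⟩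

/-- kernel `example` — THE CLASS IS INHABITED BY BOUNDED DRIFTS: for `P_k = Σ_ν diag(a_ν k)·(∇_ν ⊗ 1)` with `‖a_ν k‖_∞ ≤ α` (first-order,
UNBOUNDED as operators uniformly in `k`, since `‖∇_ν‖ ~ 2n_k`) on a cubic unit torus, and `‖t‖·(d+1)·α·B_∇K_{d+1}(δ_∇ − δ′) < 1`, the
King-averaged colour tower has level-uniform entry decay (gen 5's `wrow_diagonal_le` for the coefficients, `C₀ = 0`). [folklore] -/
example {B δg : ℝ}
    (hgrad : ∀ (n N₀ : ℕ) [NeZero n] [NeZero N₀] (δ' : ℝ), δ' < δg →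
      ∀ (ν : Fin (d + 1)) (i : Tor (fine n (fun _ : Fin (d + 1) => N₀)) × Fin (d + 1)),
        ∑ x' : Tor (fine n (fun _ : Fin (d + 1) => N₀)) × Fin (d + 1),
            Real.exp (δ' * torusSupNorm (fun _ : Fin (d + 1) => N₀)
                (rep (fun _ : Fin (d + 1) => N₀) (blockOf n (fun _ : Fin (d + 1) => N₀) i.1)
                  - rep (fun _ : Fin (d + 1) => N₀) (blockOf n (fun _ : Fin (d + 1) => N₀) x'.1)))
              * ‖(fdiff (fine n (fun _ : Fin (d + 1) => N₀)) (n : ℂ) ν * (DeltaA n (fun _ : Fin (d + 1) => N₀) 1)⁻¹) i x'‖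
          ≤ B * latticeConst (d + 1) (δg - δ'))
    (N₀ : ℕ) [NeZero N₀] (hMc : M = fun _ => N₀) {δ' : ℝ} (hδ0 : 0 ≤ δ') (hδg : δ' < δg)
    (h₁ : δ' < 1 / (2 * ((d : ℝ) + 1))) (h₂ : δ' < kappa183 (d + 1) / (d + 1))
    (a : Fin (d + 1) → (k : ℕ) → idx L M k × o → ℂ) {α : ℝ} (ha : ∀ ν k i, ‖a ν k i‖ ≤ α)
    {t : ℂ} (ht : ‖t‖ * ((d + 1) * (α * (B * latticeConst (d + 1) (δg - δ')))
        + 0 * (2 * d * 2 ^ d * Real.exp (1 / (2 * (d + 1))) * latticeConst (d + 1) (1 / (2 * (d + 1)) - δ')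
            + (d + 1) * (MD183 (d + 1) d * periodConst (kappa183 (d + 1)) d * latticeConst (d + 1) (kappa183 (d + 1) / (d + 1) - δ'))))
        < 1) (k : ℕ) :
    EntryDecay (fun x y : idx L M 0 × o => torusSupNorm M (fun ν => (((x.1.1 ν).val : ℕ) : ℤ) - (((y.1.1 ν).val : ℕ) : ℤ)))
      (pertCovC L M 1 one_pos
        (fun k => (∑ ν, Matrix.diagonal (a ν k) * (fdiff (fine (lev L k) M) ((lev L k : ℕ) : ℂ) ν ⊗ₖ (1 : Matrix o o ℂ)))
          + (0 : Matrix (idx L M k × o) (idx L M k × o) ℂ)) t k)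
      ((2 * d * 2 ^ d * Real.exp (1 / (2 * (d + 1))) * latticeConst (d + 1) (1 / (2 * (d + 1)) - δ')
            + (d + 1) * (MD183 (d + 1) d * periodConst (kappa183 (d + 1)) d * latticeConst (d + 1) (kappa183 (d + 1) / (d + 1) - δ')))
          / (1 - ‖t‖ * ((d + 1) * (α * (B * latticeConst (d + 1) (δg - δ')))
              + 0 * (2 * d * 2 ^ d * Real.exp (1 / (2 * (d + 1))) * latticeConst (d + 1) (1 / (2 * (d + 1)) - δ')
                + (d + 1) * (MD183 (d + 1) d * periodConst (kappa183 (d + 1)) d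
                  * latticeConst (d + 1) (kappa183 (d + 1) / (d + 1) - δ')))))) δ' :=
  hdec_pertCovC_firstOrder L M hgrad N₀ hMc hδ0 hδg h₁ h₂ (C := fun ν k => Matrix.diagonal (a ν k)) (C₀ := fun _ => 0)
    (fun ν k i => wrow_diagonal_le L M (a ν k) (ha ν k) δ' i) (fun k i => by simp) ht k

end Tower

end Summit.QuantumFields.BalabanUV.T4Continuum.SmallCouplingEntryDecayGrad

end
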